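import Literature.AlgebraicGeometry.AbelianSchemes.SerreTensorIdealTranslationBaseChange   -- ★ `serreTensorBaseChangeIso'`, `serreTensorBC`, `serreTranslateBC_comp_baseChangeIso`
import Literature.AlgebraicGeometry.AbelianSchemes.AbelianSchemeEquivariantFibreTransport   -- ★ p846208 TWIST-FIBRE: `IsBaseChangeVia.exists_fibreIso`, `fibreHom_comp_eq_of_left_comp_eq`
import HarnessLib

/-!
# Twisted-equivariant fibre transport: the fibre of a Serre twist is the Serre twist of the fibre, and `A_{s ≫ θ} ≅ A_s ⊗_𝒪 𝔟`
# under a twisted-equivariant structure `θ^*A ≅ A ⊗_𝒪 𝔟`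

Topic `AlgebraicGeometry/AbelianSchemes`; namespace `Literature.AlgebraicGeometry.AbelianSchemes.AbelianSchemeOver`.  THEOREMS ONLY (no
definition, no instance, no notation, no named fact, no `sorry`).  Cell `hodgecm-mathlib` (D-0151), programme P6 «MOD» (crux hLiu418 =
stmt-HodgeConjecture-24832, `--supports`, count-neutral): organ **(O-γ)(γ5)∕(F1)–(F3) «TWISTED FIBRE TRANSPORT»** of the P6a desk's deal (F0P6a-plan
(g1) ORGAN DEALS #1, A-p06 (g30) lead of (O-γ) «= A-p01 takes (γ5)»): the fibrewise reading of the (TW) field `twist_spec γ` of `ModuliDatum`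
(«`θ(γ,1)^* univ ≅ univ ⊗_{𝒪_F} 𝔞_γ`»): **the tuple at the translated point `actOf γ z̄` is the Serre twist of the tuple at `z̄`**.  Sequel of ★
`AbelianSchemeEquivariantFibreTransport` (p846208, the untwisted case) over ★ `SerreTensorBaseChange` ∕ `SerreTensorIdealTranslationBaseChange`.
HC_CM is proved only modulo the printed citations until rung 0 closes; this file is generic and changes no count.

THE PRINT ([Conrad2004GrossZagier] §7: Serre's construction `A ⊗_𝒪 𝔟` commutes with base change, as it represents `T ↦ 𝔟 ⊗_𝒪 A(T)`;
[MumfordFogartyKirwan1994] Ch. 7 §2 Def. 7.2: moduli of tuples are functors by pull-back; [GortzWedhorn2020] (4.7), Prop. 4.16: fibres of a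
pull-back).  For an abelian scheme `A∕S` with an `𝒪`-action `act`, an idempotent matrix `E` presenting the projective module `𝔟`, and a point
`s : Spec Ω → S`: (F1) the FIBRE `(A ⊗_𝒪 𝔟)_s` IS `A_s ⊗_𝒪 𝔟` as abelian varieties over `Ω` — the isomorphism ★ `serreTensorBaseChangeIso′` read in the
category of abelian varieties —, `𝒪`-equivariantly (★ `serreTensorBaseChangeIso_equivariant`) and carrying the fibre of the translation
`ψ_P : A → A ⊗ 𝔟` to the translation of the fibre (★ `serreTranslateBC_comp_baseChangeIso`); (F2) a TWISTED-EQUIVARIANT STRUCTURE — a cartesian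
square of group schemes `G : A ⊗_𝒪 𝔟 → A` over a base map `θ : S → S` (`(A ⊗ 𝔟).IsBaseChangeVia A θ G`, i.e. «`θ^*A ≅ A ⊗ 𝔟`») — identifies
`A_{s ≫ θ} ≅ (A ⊗ 𝔟)_s` naturally in every pair of endomorphisms intertwined by `G` (★ p846208); (F3) hence **`A_{s ≫ θ} ≅ A_s ⊗_𝒪 𝔟`**, intertwining
`ι(a)_{s ≫ θ}` with `ι_𝔟(a)` of the fibre whenever `G` is `𝒪`-linear.  In P6 (D-3 (TW), HEART-FROB §E): `A = univ`, `θ = θ(γ,1)`, `𝔟 = 𝔞_γ⁻¹`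
(`𝔞_{γ_σ} = (π₀) = 𝔭_w^{d_w}·𝔟`), `s = z̄ ≫ ι_s` a special point: `fibre₀Of univ (actOf γ z̄) ≅ (fibre₀Of univ z̄) ⊗ 𝔞_γ⁻¹`.

* §1 (F1) **`exists_fibreIso_serreTensor_fibre`** — `((serreTensor act E hE).fibre s).toAbelianVariety ≅ (serreTensorBC s act E hE).toAffine.toAbelianVariety`
  with its underlying group-scheme isomorphism PINNED to ★ `serreTensorBaseChangeIso′` (so every ★ square about it transfers), `𝒪`-equivariance and the
  `ψ_P`-square as corollaries on underlying morphisms;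
* §2 (F2) **`exists_fibreIso_serreTensor_of_isBaseChangeVia`** — `(A.fibre (s ≫ θ)) ≅ ((serreTensor act E hE).fibre s)` over `G`, natural (★ p846208);
* §3 (F3) **`exists_fibreIso_serreTensorBC_of_isBaseChangeVia`** — the composite `(A.fibre (s ≫ θ)) ≅ (serreTensorBC s act E hE).toAffine.toAbelianVariety`,
  `𝒪`-equivariant when `G` is.

## References
* [Conrad2004GrossZagier] B. Conrad, *Gross–Zagier revisited*, MSRI Publ. 49 (2004) — §7 (Thm. 7.5).
* [MumfordFogartyKirwan1994] D. Mumford, J. Fogarty, F. Kirwan, *Geometric Invariant Theory*, 3rd ed. (1994) — Ch. 7 §2 Def. 7.2 (p. 129).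
* [GortzWedhorn2020] U. Görtz, T. Wedhorn, *Algebraic Geometry I*, 2nd ed. (2020) — Section (4.7) (pp. 107–108), Prop. 4.16 (p. 101).
* [Kottwitz1992] R. Kottwitz, *Points on some Shimura varieties over finite fields*, JAMS 5 (1992) — §5 (p. 390) (`A ⊗_𝒪 𝔟`).
-/

noncomputable section

universe u

open CategoryTheory Limits AlgebraicGeometry MonoidalCategory CartesianMonoidalCategory MonObj

namespace Literature.AlgebraicGeometry.AbelianSchemes.AbelianSchemeOver

open Literature.AlgebraicGeometry.Motives

set_option backward.isDefEq.respectTransparency false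

variable {S : Scheme.{u}} {A : AbelianSchemeOver S} {O : Type*} [CommRing O] (act : A.RingAction O) [IsCommMonObj A.X]
  {n : ℕ} (E : Matrix (Fin n) (Fin n) O) (hE : E * E = E) {Ω : Type u} [Field Ω]

/-! ### §1 (F1) The fibre of the Serre twist is the Serre twist of the fibre -/

/-- **(F1) `(A ⊗_𝒪 𝔟)_s ≅ A_s ⊗_𝒪 𝔟` AS ABELIAN VARIETIES**, the isomorphism ★ `serreTensorBaseChangeIso′ s act E hE` of `Ω`-group schemes read in the
category of abelian varieties over `Ω` (both directions homomorphisms, ★ `isMonHom_serreTensorBaseChangeIso`): an `e` whose underlying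
morphisms ARE `(serreTensorBaseChangeIso′ …).hom ∕ .inv` — so ★ `serreTensorBaseChangeIso_equivariant` (`𝒪`-equivariance), ★
`serreTensorBaseChangeIso′_hom_serreι` (inclusions into `(A_s)ⁿ`) and ★ `serreTranslateBC_comp_baseChangeIso` (`(ψ_P)_s ≫ e = ψ_P` of `A_s`) apply
to it verbatim. [cite: Conrad2004GrossZagier, §7 (Thm. 7.5)] [cite: GortzWedhorn2020, Section (4.7) (pp. 107–108)] -/
theorem exists_fibreIso_serreTensor_fibre (s : Spec (.of Ω) ⟶ S) :
    ∃ e : ((serreTensor act E hE).fibre s).toAbelianVariety ≅ (serreTensorBC s act E hE).toAffine.toAbelianVariety,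
      e.hom.hom.hom.hom = (serreTensorBaseChangeIso' s act E hE).hom ∧ e.inv.hom.hom.hom = (serreTensorBaseChangeIso' s act E hE).inv := by
  haveI : IsMonHom (serreTensorBaseChangeIso' s act E hE).hom := (isMonHom_serreTensorBaseChangeIso s act E hE).1
  exact ⟨InducedCategory.isoMk (X := ((serreTensor act E hE).fibre s).toAbelianVariety)
      (Y := (serreTensorBC s act E hE).toAffine.toAbelianVariety) (Grp.mkIso' (serreTensorBaseChangeIso' s act E hE)), rfl, rfl⟩

/-- (F1), `𝒪`-EQUIVARIANCE on underlying morphisms: for any `e` pinned to ★ `serreTensorBaseChangeIso′`, `(ι_𝔟(a))_s ≫ e = e ≫ ι′_𝔟(a)` where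
`ι_𝔟 = serreAction act E hE` on `A ⊗ 𝔟` and `ι′_𝔟 = serreAction (act.baseChange s) E hE` on `A_s ⊗ 𝔟` (★ `serreTensorBaseChangeIso_equivariant`,
★ `serreAction_i_eq`). [cite: Conrad2004GrossZagier, §7 (Thm. 7.5)] -/
theorem fibreHom_serreAction_comp_eq (s : Spec (.of Ω) ⟶ S)
    (e : ((serreTensor act E hE).fibre s).toAbelianVariety ≅ (serreTensorBC s act E hE).toAffine.toAbelianVariety)
    (he : e.hom.hom.hom.hom = (serreTensorBaseChangeIso' s act E hE).hom) (a : O) :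
    haveI := (serreAction act E hE).isMonHom a
    (fibreHom ((serreAction act E hE).i a) s).hom.hom.hom ≫ e.hom.hom.hom.hom =
      e.hom.hom.hom.hom ≫ (@serreAction _ (A.baseChange s) O _ (act.baseChange s) (isCommMonObj_baseChange s) n E hE).i a := by
  haveI := (serreAction act E hE).isMonHom a
  rw [fibreHom_hom_hom_hom, he]
  exact serreTensorBaseChangeIso_equivariant s act E hE a

/-- (F1), THE TRANSLATION SQUARE on underlying morphisms: `(ψ_P)_s ≫ e = ψ_P(A_s)` for the ideal translation `ψ_P = serreTranslate act E hE P`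
(★ `serreTranslateBC_comp_baseChangeIso`). [cite: Conrad2004GrossZagier, §7 (Thm. 7.5)] -/
theorem fibreHom_serreTranslate_comp_eq (s : Spec (.of Ω) ⟶ S) {m : ℕ} (E' : Matrix (Fin m) (Fin m) O) (hE' : E' * E' = E')
    (P : Matrix (Fin m) (Fin 1) O) (hP : E' * P = P)
    (e : ((serreTensor act E' hE').fibre s).toAbelianVariety ≅ (serreTensorBC s act E' hE').toAffine.toAbelianVariety)
    (he : e.hom.hom.hom.hom = (serreTensorBaseChangeIso' s act E' hE').hom) :
    haveI := isMonHom_serreTranslate act E' hE' P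
    (fibreHom (serreTranslate act E' hE' P) s).hom.hom.hom ≫ e.hom.hom.hom.hom =
      @serreTranslate _ (A.baseChange s) O _ (act.baseChange s) (isCommMonObj_baseChange s) m E' hE' P := by
  haveI := isMonHom_serreTranslate act E' hE' P
  rw [fibreHom_hom_hom_hom, he]
  exact serreTranslateBC_comp_baseChangeIso s act P E' hE' hP

/-! ### §2 (F2) The fibre at the translated point under a twisted-equivariant structure -/

/-- **(F2) `A_{s ≫ θ} ≅ (A ⊗_𝒪 𝔟)_s` UNDER A TWISTED-EQUIVARIANT STRUCTURE.**  If `G : A ⊗_𝒪 𝔟 → A` over `θ : S → S` is a cartesian square of group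
schemes (`(serreTensor act E hE).IsBaseChangeVia A θ G` — «`θ^*A ≅ A ⊗ 𝔟`»), then for every point `s` there is `e : A_{s ≫ θ} ≅ (A ⊗ 𝔟)_s` over `G`
(`e⁻¹ ≫ pr_A = pr ≫ G`), NATURAL: `k′_s ≫ e⁻¹ = e⁻¹ ≫ k_{s ≫ θ}` for all homomorphisms `k′` of `A ⊗ 𝔟`, `k` of `A` with `k′ ≫ G = G ≫ k` (★ p846208).
[cite: MumfordFogartyKirwan1994, Ch. 7 §2 Definition 7.2 (p. 129)] [cite: GortzWedhorn2020, Section (4.7) (pp. 107–108) and Prop. 4.16 (p. 101)] -/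
theorem exists_fibreIso_serreTensor_of_isBaseChangeVia {θ : S ⟶ S} {G : (serreTensor act E hE).X.left ⟶ A.X.left}
    (hG : (serreTensor act E hE).IsBaseChangeVia A θ G) (s : Spec (.of Ω) ⟶ S) :
    ∃ e : (A.fibre (s ≫ θ)).toAbelianVariety ≅ ((serreTensor act E hE).fibre s).toAbelianVariety,
      AbelianVariety.Hom.toSchemeHom e.inv ≫ pullback.fst A.X.hom (s ≫ θ) = pullback.fst (serreTensor act E hE).X.hom s ≫ G ∧
      ∀ (k' : (serreTensor act E hE).X ⟶ (serreTensor act E hE).X) [IsMonHom k'] (k : A.X ⟶ A.X) [IsMonHom k],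
        k'.left ≫ G = G ≫ k.left → fibreHom k' s ≫ e.inv = e.inv ≫ fibreHom k (s ≫ θ) := by
  obtain ⟨e, he⟩ := hG.exists_fibreIso s
  exact ⟨e.symm, he, fun k' _ k _ hk => fibreHom_comp_eq_of_left_comp_eq s e he e he k' k hk⟩

/-! ### §3 (F3) The composite: `A_{s ≫ θ} ≅ A_s ⊗_𝒪 𝔟`, `𝒪`-equivariantly -/

/-- **(F3) TWISTED-EQUIVARIANT FIBRE TRANSPORT: `A_{s ≫ θ} ≅ A_s ⊗_𝒪 𝔟`.**  Under a twisted-equivariant structure `G` as in (F2) which is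
`𝒪`-LINEAR (`ι_𝔟(a) ≫ G = G ≫ ι(a)` for all `a`), the fibre at the translated point is the Serre twist of the fibre: an isomorphism of abelian
varieties `e : (A.fibre (s ≫ θ)) ≅ (A_s ⊗_𝒪 𝔟)` whose underlying morphisms intertwine `ι(a)_{s ≫ θ}` with the Serre action `ι′_𝔟(a)` of the
base-changed action ((F2) composed with (F1)).  In P6: `fibre₀Of univ (actOf γ z̄) ≅ (fibre₀Of univ z̄) ⊗ 𝔞_γ⁻¹`, `𝒪_F`-equivariantly.
[cite: Conrad2004GrossZagier, §7 (Thm. 7.5)] [cite: MumfordFogartyKirwan1994, Ch. 7 §2 Definition 7.2 (p. 129)] [cite: Kottwitz1992, §5 (p. 390)] -/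
theorem exists_fibreIso_serreTensorBC_of_isBaseChangeVia {θ : S ⟶ S} {G : (serreTensor act E hE).X.left ⟶ A.X.left}
    (hG : (serreTensor act E hE).IsBaseChangeVia A θ G)
    (hGlin : ∀ a : O, ((serreAction act E hE).i a).left ≫ G = G ≫ (act.i a).left) (s : Spec (.of Ω) ⟶ S) :
    ∃ e : (A.fibre (s ≫ θ)).toAbelianVariety ≅ (serreTensorBC s act E hE).toAffine.toAbelianVariety,
      ∀ a : O, haveI := act.isMonHom a
        (fibreHom (act.i a) (s ≫ θ)).hom.hom.hom ≫ e.hom.hom.hom.hom =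
          e.hom.hom.hom.hom ≫ (@serreAction _ (A.baseChange s) O _ (act.baseChange s) (isCommMonObj_baseChange s) n E hE).i a := by
  obtain ⟨e₂, -, hnat⟩ := exists_fibreIso_serreTensor_of_isBaseChangeVia act E hE hG s
  obtain ⟨e₁, he₁, -⟩ := exists_fibreIso_serreTensor_fibre act E hE s
  refine ⟨e₂ ≪≫ e₁, fun a => ?_⟩
  haveI := act.isMonHom a
  haveI := (serreAction act E hE).isMonHom a
  -- (F2) for the pair `ι_𝔟(a)`, `ι(a)`: `ι_𝔟(a)_s ≫ e₂⁻¹ = e₂⁻¹ ≫ ι(a)_{s ≫ θ}`, i.e. `ι(a)_{s ≫ θ} ≫ e₂ = e₂ ≫ ι_𝔟(a)_s`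
  have h2 := hnat ((serreAction act E hE).i a) (act.i a) (hGlin a)
  have h2' : fibreHom (act.i a) (s ≫ θ) ≫ e₂.hom = e₂.hom ≫ fibreHom ((serreAction act E hE).i a) s := by
    rw [← cancel_mono e₂.inv, Category.assoc, Category.assoc, e₂.hom_inv_id, Category.comp_id, h2, ← Category.assoc, e₂.hom_inv_id,
      Category.id_comp]
  -- (F1) for `a`
  have h1 := fibreHom_serreAction_comp_eq act E hE s e₁ he₁ a
  -- assemble on underlying morphisms
  have h2'' : (fibreHom (act.i a) (s ≫ θ)).hom.hom.hom ≫ e₂.hom.hom.hom.hom =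
      e₂.hom.hom.hom.hom ≫ (fibreHom ((serreAction act E hE).i a) s).hom.hom.hom :=
    congrArg (fun f => f.hom.hom.hom) h2'
  change (fibreHom (act.i a) (s ≫ θ)).hom.hom.hom ≫ (e₂.hom.hom.hom.hom ≫ e₁.hom.hom.hom.hom) =
    (e₂.hom.hom.hom.hom ≫ e₁.hom.hom.hom.hom) ≫ _
  rw [← Category.assoc, h2'', Category.assoc, h1, Category.assoc]

end Literature.AlgebraicGeometry.AbelianSchemes.AbelianSchemeOver

end
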